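import Summits.BirchSwinnertonDyer.Rank1Residual.AdditivePotMult.RankZeroTwistHeights
import Literature.NumberTheory.EllipticCurves.Disegni2017.ChiPairingsSignCharacterProofs
import Literature.NumberTheory.EllipticCurves.HeightsBaseChangeProofs
import Literature.NumberTheory.EllipticCurves.QuadraticTwistRank
import HarnessLib

/-!
# Road (C) `disegni-pair-two` on crux stmt-BirchSwinnertonDyer-20368 — SEAM S1: Disegni's `χ`-isotypic
# pairings of the road-(C) pair EVALUATE ON THE MEMBER (`χ`-line = `ℚ·P′`, biquadratic descent)

Cell `bsd-print-cf2` (`run/shared/lean/pub/bsd-print-cf2/`), width seat `bsd-line-cf2-p1-w8` g22.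
`--supports stmt-BirchSwinnertonDyer-20368` (helper). THEOREMS ONLY (no `def`, no named fact, no `sorry`);
conditional on every displayed hypothesis. BSD is not proved by any of this; no summit statement is
claimed; 20368 is not closed by this file.

## The seam (typer residue (R2) of `bsd-print-cf2-ty2` g49; planner PREGRADE §3 «DH any datum PINNED on
## the image of W(ℚ) to the receptacle»)

Road (C) reads Disegni 2017 Thm B ÷ YZZ (1.1.3) (`Disegni2017.ChiLineGrossZagierClauses ι E′ V H f a χ_H 𝔭 𝔭′ G χ DH`,
file `Literature/…/Disegni2017/ChiLineGrossZagier.lean`) at the pair (`V` = the good twist `cm7^{(d′)}`,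
`χ_H = ε_{d*}∘N_{E′}`), on `H = E′(√d*)` with `G = Gal(H/E′) = {1, τ}` and `χ` the SIGN character. In
that predicate the `H`-points `y₁, y₂` and `q ≠ 0` are existential; both clauses must therefore be
evaluated at an ARBITRARY pair `(y₁, y₂)`. This file supplies the geometric half of that evaluation:

* §1 BIQUADRATIC DESCENT (abstract): `τ, κ` two commuting involutions of `H/ℚ` whose common fixed
  points are rational (`hfix`), an additive isomorphism `Φ : V^{(d)}(H) ≃ V(H)` ANTI-commuting with `τ`
  and commuting with `κ` (the twist substitution for `t = √d`, `τt = −t`, `κt = t`), and an additive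
  isomorphism `Ψ : V^{(d)(e)}(H) ≃ V^{(d)}(H)` commuting with `τ` and ANTI-commuting with `κ` (the
  substitution for `u = √e`, `e = d_{E′}`, `τu = u`, `κu = −u`). If `V^{(d)}(ℚ) = ℤ·P ⊕ torsion` and
  `V^{(d)(e)}(ℚ)` is torsion, then EVERY `R ∈ V(H)` with `τR = −R` satisfies
  `2R = k·Φ(ιP) + T`, `T` torsion (`two_smul_eq_zsmul_add_torsion_of_neg`): with `Q = Φ⁻¹R` (`τ`-fixed),
  `Q + κQ` is fixed by `τ, κ`, hence rational, hence `≡ kP`; `Q − κQ = Ψ(Q₃)` with `Q₃` fixed by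
  `τ, κ`, hence rational on the companion twist, hence torsion.
* §2 the substitutions of cell `b2b-bsdres` (`twistPointEquivOver`, its naturality
  `map_twistPointEquivOver[_of_neg]`) discharge the four commutation hypotheses, and
  `canonicalHeight_twistPointEquivOver` + `canonicalHeight_baseChange` give
  `ĥ_H(P′) = [H:ℚ]·ĥ(P)` for `P′ := Φ_H(ιP)` (`canonicalHeight_memberPoint`).
* §3 THE SEAM (`exists_rat_chiPairings_eq`): with the sign-character evaluations of
  `Disegni2017/ChiPairingsSignCharacterProofs.lean`, for ALL `y₁, y₂ ∈ V(H)` there is ONE `r ∈ ℚ` with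
  `chiHeightPairing V H G χ y₁ y₂ = r·[H:ℚ]·ĥ(P)` AND, for every `G`-invariant datum `DH`,
  `chiPAdicPairing ι V H DH G χ y₁ y₂ = r·⟨P′, P′⟩_{DH}` — so a PIN hypothesis stated ON `P′`
  (`⟨P′, P′⟩_{DH} = canonicalPAdicHeightSqMinusTwist V 2 d* P`, the (U5d) receptacle; sign-insensitive)
  turns both of Disegni's clauses into statements about the member's generator with the SAME `r`, and
  the consumer may divide them (this is where `q` cancels).

References: D. Disegni, Compos. Math. 153 (2017) §1.1.1, (1.1.3), (1.3.2), Thm. B [Disegni2017];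
J. H. Silverman, AEC (2009) X.2 Prop. 2.4, X.5 Cor. 5.4, Exercise 10.16, VIII.5.4(b), VIII.9.1
[SilvermanAEC2009]; B. Gross, D. Zagier, Invent. Math. 84 (1986) V.§2 p. 311 (the `P_K ± P̄_K` descent)
[GrossZagier1986].
-/

set_option autoImplicit false
set_option linter.dupNamespace false

noncomputable section

open scoped Classical

open WeierstrassCurve WeierstrassCurve.Affine.Point Literature.NumberTheory.EllipticCurves
  Literature.NumberTheory.EllipticCurves.Disegni2017
  Summit.BirchSwinnertonDyer.Rank1Residual.AdditivePotMult

namespace Summit.BirchSwinnertonDyer.BirchSwinnertonDyer.Theorems.PrintCf2.DisegniPairTwo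

universe u

/-! ### §1 Biquadratic descent for an abstract pair of twist substitutions -/

section Descent

variable {H : Type} [Field H] [CharZero H] (τ κ : H ≃ₐ[ℚ] H)

/-- Two field automorphisms that commute on elements commute on points. [folklore] -/
theorem map_map_comm_of_apply_comm {X : WeierstrassCurve ℚ} (hcomm : ∀ x : H, τ (κ x) = κ (τ x))
    (Q : (X.baseChange H).toAffine.Point) :
    Affine.Point.map (W' := X) (τ : H →ₐ[ℚ] H) (Affine.Point.map (W' := X) (κ : H →ₐ[ℚ] H) Q) =
      Affine.Point.map (W' := X) (κ : H →ₐ[ℚ] H) (Affine.Point.map (W' := X) (τ : H →ₐ[ℚ] H) Q) := by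
  rcases Q with _ | ⟨x, y, h⟩
  · rfl
  · simp only [Affine.Point.map_some, AlgEquiv.coe_toAlgHom, hcomm]

/-- An involution of the field acts as an involution on points. [folklore] -/
theorem map_map_self_of_involutive {X : WeierstrassCurve ℚ} (hκκ : ∀ x : H, κ (κ x) = x)
    (Q : (X.baseChange H).toAffine.Point) :
    Affine.Point.map (W' := X) (κ : H →ₐ[ℚ] H) (Affine.Point.map (W' := X) (κ : H →ₐ[ℚ] H) Q) = Q := by
  rcases Q with _ | ⟨x, y, h⟩
  · rfl
  · simp only [Affine.Point.map_some, AlgEquiv.coe_toAlgHom, hκκ]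

/-- **Points fixed by `τ` and `κ` are rational** when the common fixed field of `τ, κ` is `ℚ` (the
hypothesis `hfix`; e.g. `H/ℚ` biquadratic Galois with group `{1, τ, κ, τκ}`). Silverman, AEC Exercise 10.16
(the descent step). [cite: SilvermanAEC2009, Exercise 10.16] -/
theorem exists_incl_eq_of_map_eq {X : WeierstrassCurve ℚ}
    (hfix : ∀ x : H, τ x = x → κ x = x → ∃ q : ℚ, algebraMap ℚ H q = x)
    {Q : (X.baseChange H).toAffine.Point}
    (hτ : Affine.Point.map (W' := X) (τ : H →ₐ[ℚ] H) Q = Q)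
    (hκ : Affine.Point.map (W' := X) (κ : H →ₐ[ℚ] H) Q = Q) :
    ∃ Q₀ : X.toAffine.Point, QuadraticDescent.incl H X Q₀ = Q := by
  rcases Q with _ | ⟨x, y, h⟩
  · exact ⟨0, rfl⟩
  · rw [Affine.Point.map_some] at hτ hκ
    simp only [AlgEquiv.coe_toAlgHom, Affine.Point.some.injEq] at hτ hκ
    obtain ⟨a, ha⟩ := hfix x hτ.1 hκ.1
    obtain ⟨b, hb⟩ := hfix y hτ.2 hκ.2
    exact QuadraticDescent.exists_incl_eq X h ha hb

variable {V : WeierstrassCurve ℚ} {d e : ℚ}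
  (Φ : ((V.quadraticTwist d).baseChange H).toAffine.Point ≃+ (V.baseChange H).toAffine.Point)
  (Ψ : (((V.quadraticTwist d).quadraticTwist e).baseChange H).toAffine.Point ≃+
    ((V.quadraticTwist d).baseChange H).toAffine.Point)

/-- **BIQUADRATIC DESCENT — the `χ`-line of `V(H)` is `ℚ·Φ(ιP)`.** Let `τ, κ` be commuting involutions
of `H/ℚ` with rational common fixed points; `Φ : V^{(d)}(H) ≃ V(H)` additive with `τΦ = −Φτ`, `κΦ = Φκ`;
`Ψ : V^{(d)(e)}(H) ≃ V^{(d)}(H)` additive with `τΨ = Ψτ`, `κΨ = −Ψκ`; `V^{(d)}(ℚ) = ℤP + torsion` and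
`V^{(d)(e)}(ℚ)` torsion, both READ IN `H` through the inclusion `ι` (`QuadraticDescent.incl`; the
`ℚ`-side forms are converted in §2). Then every `R ∈ V(H)` with `τR = −R` has `2R = k·Φ(ιP) + T` with
`T` of finite order. (Gross–Zagier's `P_K ± P̄_K` descent, V.§2 p. 311, run twice: `Q = Φ⁻¹R` is
`τ`-fixed; `Q + κQ` is rational; `Q − κQ = Ψ(Q₃)` with `Q₃` rational on the companion twist.)
[cite: GrossZagier1986, V.§2 (p. 311)] [cite: SilvermanAEC2009, Exercise 10.16] -/
theorem two_smul_eq_zsmul_add_torsion_of_neg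
    (hcomm : ∀ x : H, τ (κ x) = κ (τ x)) (hκκ : ∀ x : H, κ (κ x) = x)
    (hfix : ∀ x : H, τ x = x → κ x = x → ∃ q : ℚ, algebraMap ℚ H q = x)
    (hΦτ : ∀ Q, Affine.Point.map (W' := V) (τ : H →ₐ[ℚ] H) (Φ Q) =
      -Φ (Affine.Point.map (W' := V.quadraticTwist d) (τ : H →ₐ[ℚ] H) Q))
    (hΨτ : ∀ Q, Affine.Point.map (W' := V.quadraticTwist d) (τ : H →ₐ[ℚ] H) (Ψ Q) =
      Ψ (Affine.Point.map (W' := (V.quadraticTwist d).quadraticTwist e) (τ : H →ₐ[ℚ] H) Q))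
    (hΨκ : ∀ Q, Affine.Point.map (W' := V.quadraticTwist d) (κ : H →ₐ[ℚ] H) (Ψ Q) =
      -Ψ (Affine.Point.map (W' := (V.quadraticTwist d).quadraticTwist e) (κ : H →ₐ[ℚ] H) Q))
    {P : (V.quadraticTwist d).toAffine.Point}
    (hgen : ∀ R : (V.quadraticTwist d).toAffine.Point,
      ∃ (k : ℤ) (T : ((V.quadraticTwist d).baseChange H).toAffine.Point), IsOfFinAddOrder T ∧
        QuadraticDescent.incl H (V.quadraticTwist d) R = k • QuadraticDescent.incl H (V.quadraticTwist d) P + T)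
    (htors : ∀ Q : ((V.quadraticTwist d).quadraticTwist e).toAffine.Point,
      IsOfFinAddOrder (QuadraticDescent.incl H ((V.quadraticTwist d).quadraticTwist e) Q))
    (R : (V.baseChange H).toAffine.Point)
    (hR : Affine.Point.map (W' := V) (τ : H →ₐ[ℚ] H) R = -R) :
    ∃ (k : ℤ) (T : (V.baseChange H).toAffine.Point), IsOfFinAddOrder T ∧
      (2 : ℤ) • R = k • Φ (QuadraticDescent.incl H (V.quadraticTwist d) P) + T := by
  -- `Q := Φ⁻¹ R` is `τ`-fixed
  obtain ⟨Q, rfl⟩ : ∃ Q, Φ Q = R := ⟨Φ.symm R, Φ.apply_symm_apply R⟩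
  have hτQ : Affine.Point.map (W' := V.quadraticTwist d) (τ : H →ₐ[ℚ] H) Q = Q := by
    apply Φ.injective
    have h := hΦτ Q
    rw [hR, neg_inj] at h
    exact h.symm
  set κQ := Affine.Point.map (W' := V.quadraticTwist d) (κ : H →ₐ[ℚ] H) Q with hκQ_def
  -- `Q₁ := Q + κQ` is fixed by `τ` and `κ`, hence rational, hence `≡ k P`
  have hτQ₁ : Affine.Point.map (W' := V.quadraticTwist d) (τ : H →ₐ[ℚ] H) (Q + κQ) = Q + κQ := by
    rw [map_add, hτQ, hκQ_def, map_map_comm_of_apply_comm τ κ hcomm, hτQ]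
  have hκQ₁ : Affine.Point.map (W' := V.quadraticTwist d) (κ : H →ₐ[ℚ] H) (Q + κQ) = Q + κQ := by
    rw [map_add, hκQ_def, map_map_self_of_involutive κ hκκ, add_comm]
  obtain ⟨P₁, hP₁⟩ := exists_incl_eq_of_map_eq τ κ hfix hτQ₁ hκQ₁
  obtain ⟨k, T₀, hT₀, hP₁k⟩ := hgen P₁
  -- `Q₂ := Q − κQ` is `τ`-fixed and `κ`-anti-fixed, hence `Ψ` of a rational point of the companion
  have hτQ₂ : Affine.Point.map (W' := V.quadraticTwist d) (τ : H →ₐ[ℚ] H) (Q - κQ) = Q - κQ := by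
    rw [map_sub, hτQ, hκQ_def, map_map_comm_of_apply_comm τ κ hcomm, hτQ]
  have hκQ₂ : Affine.Point.map (W' := V.quadraticTwist d) (κ : H →ₐ[ℚ] H) (Q - κQ) = -(Q - κQ) := by
    rw [map_sub, hκQ_def, map_map_self_of_involutive κ hκκ, neg_sub]
  obtain ⟨Q₃, hΨQ₃⟩ : ∃ Q₃, Ψ Q₃ = Q - κQ := ⟨Ψ.symm (Q - κQ), Ψ.apply_symm_apply _⟩
  have hτQ₃ : Affine.Point.map (W' := (V.quadraticTwist d).quadraticTwist e) (τ : H →ₐ[ℚ] H) Q₃ = Q₃ := by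
    apply Ψ.injective
    rw [← hΨτ, hΨQ₃, hτQ₂]
  have hκQ₃ : Affine.Point.map (W' := (V.quadraticTwist d).quadraticTwist e) (κ : H →ₐ[ℚ] H) Q₃ = Q₃ := by
    apply Ψ.injective
    have h := hΨκ Q₃
    rw [hΨQ₃, hκQ₂, neg_inj] at h
    rw [← h, hΨQ₃]
  obtain ⟨Q₄, hQ₄⟩ := exists_incl_eq_of_map_eq τ κ hfix hτQ₃ hκQ₃
  have hQ₃tors : IsOfFinAddOrder Q₃ := hQ₄ ▸ htors Q₄
  have hQ₂tors : IsOfFinAddOrder (Q - κQ) := hΨQ₃ ▸ Ψ.toAddMonoidHom.isOfFinAddOrder hQ₃tors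
  -- assemble: `2Q = (Q + κQ) + (Q − κQ) = k ιP + (T₀ + (Q − κQ))`
  have h2Q : (2 : ℤ) • Q = k • QuadraticDescent.incl H (V.quadraticTwist d) P + (T₀ + (Q - κQ)) := by
    have h : (2 : ℤ) • Q = (Q + κQ) + (Q - κQ) := by rw [two_zsmul]; abel
    rw [h, ← hP₁, hP₁k]
    abel
  refine ⟨k, Φ (T₀ + (Q - κQ)), Φ.toAddMonoidHom.isOfFinAddOrder (hT₀.add hQ₂tors), ?_⟩
  rw [← map_zsmul, h2Q, map_add, map_zsmul]

end Descent

/-! ### §2 The substitutions `Φ_H`, `Ψ_H` of cell `b2b-bsdres` and the member's point `P′ = Φ_H(ιP)` -/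

section Member

variable {H : Type} [Field H] [NumberField H] (V : WeierstrassCurve ℚ) {d : ℚ} {t : H}
  (ht : t ∉ Set.range (algebraMap ℚ H)) (htd : t ^ 2 = algebraMap ℚ H d)

/-- **The Galois action on the member's `H`-point**: for `σ ∈ Aut(H/ℚ)` with `σt = t`,
`σ(Φ_H(ιP)) = Φ_H(ιP)`. [cite: SilvermanAEC2009, X.5 Cor. 5.4] -/
theorem map_memberPoint_of_eq (σ : H ≃ₐ[ℚ] H) (hσ : σ t = t) (P : (V.quadraticTwist d).toAffine.Point) :
    Affine.Point.map (W' := V) (σ : H →ₐ[ℚ] H)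
        (twistPointEquivOver V ht htd (QuadraticDescent.incl H (V.quadraticTwist d) P)) =
      twistPointEquivOver V ht htd (QuadraticDescent.incl H (V.quadraticTwist d) P) := by
  rw [map_twistPointEquivOver V ht htd ht htd (σ : H →ₐ[ℚ] H) (by simpa using hσ),
    QuadraticDescent.conjMap_incl]

/-- **The Galois action on the member's `H`-point**: for `σ ∈ Aut(H/ℚ)` with `σt = −t`,
`σ(Φ_H(ιP)) = −Φ_H(ιP)` — the point lies on the `χ`-line of the sign character.
[cite: SilvermanAEC2009, X.5 Cor. 5.4] [cite: Disegni2017, §1.1.1 A(χ) (arXiv v3 PDF p. 3 L40)] -/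
theorem map_memberPoint_of_eq_neg (σ : H ≃ₐ[ℚ] H) (hσ : σ t = -t) (P : (V.quadraticTwist d).toAffine.Point) :
    Affine.Point.map (W' := V) (σ : H →ₐ[ℚ] H)
        (twistPointEquivOver V ht htd (QuadraticDescent.incl H (V.quadraticTwist d) P)) =
      -twistPointEquivOver V ht htd (QuadraticDescent.incl H (V.quadraticTwist d) P) := by
  rw [map_twistPointEquivOver_of_neg V ht htd ht htd (σ : H →ₐ[ℚ] H) (by simpa using hσ),
    QuadraticDescent.conjMap_incl]

/-- **`ĥ_H(P′) = [H:ℚ]·ĥ_ℚ(P)`** for the member's `H`-point `P′ = Φ_H(ιP)` (`Φ_H` preserves heights —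
`canonicalHeight_twistPointEquivOver` — and base change multiplies them by the degree — Silverman AEC
VIII.5.4(b), tree `canonicalHeight_baseChange`). [cite: SilvermanAEC2009, Prop. VIII.9.1 and Prop. VIII.5.4(b)] -/
theorem canonicalHeight_memberPoint [(V.quadraticTwist d).IsElliptic] (P : (V.quadraticTwist d).toAffine.Point) :
    canonicalHeight (twistPointEquivOver V ht htd (QuadraticDescent.incl H (V.quadraticTwist d) P)) =
      (Module.finrank ℚ H : ℝ) * canonicalHeight P := by
  rw [canonicalHeight_twistPointEquivOver]
  exact canonicalHeight_baseChange (R := ℚ) (K := ℚ) (L := H) (W := V.quadraticTwist d) P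

/-- The inclusion `ι : X(ℚ) → X(H)` on a `ℤ`-combination: `ι(k·P + T) = k·ιP + ιT`. (The tree's
`QuadraticDescent.incl` is Mathlib's base-change map typed over a GENERIC base field, so its bundled
additivity refers to the classical decidability instance on `X(ℚ)`; the group law on `X(ℚ)` written in a
file over `ℚ` uses the computable one. The two maps agree pointwise by `rfl`, and Mathlib's map elaborated
HERE carries the additivity in the instance the consumer's hypotheses use.) [folklore] -/
theorem incl_zsmul_add (X : WeierstrassCurve ℚ) (k : ℤ) (P T : X.toAffine.Point) :
    QuadraticDescent.incl H X (k • P + T) =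
      k • QuadraticDescent.incl H X P + QuadraticDescent.incl H X T := by
  set ι : X.toAffine.Point →+ (X.baseChange H).toAffine.Point :=
    Affine.Point.baseChange (W' := X) ℚ H with hι_def
  have hι : ∀ R : X.toAffine.Point, QuadraticDescent.incl H X R = ι R := fun _ => rfl
  rw [hι, hι, hι, map_add, map_zsmul]

/-- The inclusion `ι : X(ℚ) → X(H)` carries torsion points to torsion points (same remark on instances
as for `incl_zsmul_add`). [folklore] -/
theorem isOfFinAddOrder_incl (X : WeierstrassCurve ℚ) {T : X.toAffine.Point} (hT : IsOfFinAddOrder T) :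
    IsOfFinAddOrder (QuadraticDescent.incl H X T) := by
  set ι : X.toAffine.Point →+ (X.baseChange H).toAffine.Point :=
    Affine.Point.baseChange (W' := X) ℚ H with hι_def
  have hι : QuadraticDescent.incl H X T = ι T := rfl
  rw [hι]
  exact ι.isOfFinAddOrder hT

/-- **BIQUADRATIC DESCENT for the road-(C) substitutions.** `H ∋ t, u` with `t² = d`, `u² = e`
(`t, u ∉ ℚ`); `τ, κ ∈ Aut(H/ℚ)` commuting involutions with `τt = −t`, `τu = u`, `κu = −u` and rational
common fixed points; `V^{(d)}(ℚ) = ℤP + torsion`; `V^{(de)}(ℚ)` torsion (read on the model `(V^{(d)})^{(e)}`,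
which IS `V^{(de)}`: `quadraticTwist_quadraticTwist`). Then every `R ∈ V(H)` with `τR = −R` satisfies
`2R = k·Φ_H(ιP) + T`, `T` of finite order, `Φ_H = twistPointEquivOver V ht htd`.
[cite: GrossZagier1986, V.§2 (p. 311)] [cite: SilvermanAEC2009, X.5 Cor. 5.4 and Exercise 10.16] -/
theorem two_smul_eq_zsmul_memberPoint_add_torsion {e : ℚ} {u : H}
    (hu : u ∉ Set.range (algebraMap ℚ H)) (hue : u ^ 2 = algebraMap ℚ H e) (τ κ : H ≃ₐ[ℚ] H)
    (hcomm : ∀ x : H, τ (κ x) = κ (τ x)) (hκκ : ∀ x : H, κ (κ x) = x)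
    (hfix : ∀ x : H, τ x = x → κ x = x → ∃ q : ℚ, algebraMap ℚ H q = x)
    (hτt : τ t = -t) (hτu : τ u = u) (hκu : κ u = -u)
    {P : (V.quadraticTwist d).toAffine.Point}
    (hgen : ∀ R : (V.quadraticTwist d).toAffine.Point,
      ∃ (k : ℤ) (T : (V.quadraticTwist d).toAffine.Point), IsOfFinAddOrder T ∧ R = k • P + T)
    (htors : ∀ Q : ((V.quadraticTwist d).quadraticTwist e).toAffine.Point, IsOfFinAddOrder Q)
    (R : (V.baseChange H).toAffine.Point)
    (hR : Affine.Point.map (W' := V) (τ : H →ₐ[ℚ] H) R = -R) :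
    ∃ (k : ℤ) (T : (V.baseChange H).toAffine.Point), IsOfFinAddOrder T ∧
      (2 : ℤ) • R = k • twistPointEquivOver V ht htd (QuadraticDescent.incl H (V.quadraticTwist d) P) + T :=
  two_smul_eq_zsmul_add_torsion_of_neg τ κ (twistPointEquivOver V ht htd)
    (twistPointEquivOver (V.quadraticTwist d) hu hue) hcomm hκκ hfix
    (fun Q => map_twistPointEquivOver_of_neg V ht htd ht htd (τ : H →ₐ[ℚ] H) (by simpa using hτt) Q)
    (fun Q => map_twistPointEquivOver (V.quadraticTwist d) hu hue hu hue (τ : H →ₐ[ℚ] H)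
      (by simpa using hτu) Q)
    (fun Q => map_twistPointEquivOver_of_neg (V.quadraticTwist d) hu hue hu hue (κ : H →ₐ[ℚ] H)
      (by simpa using hκu) Q)
    (fun R => by
      obtain ⟨k, T, hT, hRk⟩ := hgen R
      exact ⟨k, QuadraticDescent.incl H (V.quadraticTwist d) T, isOfFinAddOrder_incl _ hT,
        by rw [hRk, incl_zsmul_add]⟩)
    (fun Q => isOfFinAddOrder_incl _ (htors Q)) R hR

/-- The companion-torsion hypothesis transported from the model `V^{(de)}` to `(V^{(d)})^{(e)}` (the two
Weierstrass equations coincide, `quadraticTwist_quadraticTwist`). [folklore] -/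
theorem forall_isOfFinAddOrder_quadraticTwist_quadraticTwist {e : ℚ}
    (h : ∀ Q : (V.quadraticTwist (d * e)).toAffine.Point, IsOfFinAddOrder Q) :
    ∀ Q : ((V.quadraticTwist d).quadraticTwist e).toAffine.Point, IsOfFinAddOrder Q := fun Q => by
  have hQ := h (Affine.Point.congrEquiv (quadraticTwist_quadraticTwist V d e) Q)
  have h' := (Affine.Point.congrEquiv (quadraticTwist_quadraticTwist V d e)).symm.toAddMonoidHom.isOfFinAddOrder hQ
  simpa using h'

end Member

/-! ### §3 THE SEAM: both `χ`-pairings of Disegni's clauses read ONE rational multiple of the member's height -/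

section Seam

variable {H : Type} [Field H] [NumberField H] (V : WeierstrassCurve ℚ) {d e : ℚ} {t u : H}
  (ht : t ∉ Set.range (algebraMap ℚ H)) (htd : t ^ 2 = algebraMap ℚ H d)
  (G : Subgroup (H ≃ₐ[ℚ] H)) (χ : G →* ℂˣ) (s : G → ℤ)

/-- The projector of a sign character lies on the `χ`-line: for `τ ∈ G` with `s(τ) = −1`,
`τ(Y_χ y) = −Y_χ y` (as Mathlib's `Affine.Point.map τ`). [cite: Disegni2017, §1.1.1 A(χ) (arXiv v3 PDF p. 3 L40)] -/
theorem map_sum_sign_smul_eq_neg (hs : ∀ σ, ((χ σ : ℂˣ) : ℂ) = (s σ : ℂ)) {τ : H ≃ₐ[ℚ] H} (hτG : τ ∈ G)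
    (hsτ : s ⟨τ, hτG⟩ = -1) (y : (V.baseChange H).toAffine.Point) :
    Affine.Point.map (W' := V) (τ : H →ₐ[ℚ] H) (∑ σ : G, s σ • pointGalHom V H σ.1 y) =
      -∑ σ : G, s σ • pointGalHom V H σ.1 y := by
  have h := pointGalHom_sum_sign_smul G χ s hs ⟨τ, hτG⟩ y
  rw [hsτ, neg_one_zsmul] at h
  rw [← pointGalHom_apply]
  exact h

/-- **THE SEAM (road (C), crux `PrintCf2.SplitBadTwoRankOneOfFacts`).** Frame: `V/ℚ` elliptic, the member
`W = V^{(d)}` with `V^{(d)}(ℚ) = ℤP + torsion`, the companion `V^{(de)}(ℚ)` torsion (on the model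
`(V^{(d)})^{(e)}`); `H ∋ t, u` a number field with `t² = d`, `u² = e`, `t, u ∉ ℚ`; `τ, κ ∈ Aut(H/ℚ)` commuting
involutions with `τt = −t`, `τu = u`, `κu = −u` and rational common fixed points (`H = E′(√d)`, `E′ = ℚ(u)`:
`τ` generates `Gal(H/E′)`, `κ` lifts the conjugation of `E′`); `G ≤ Aut(H/ℚ)` containing `τ` and
`χ : G →* ℂˣ` a SIGN character (`χ = s`, `s(τ) = −1`). Then for ALL `y₁, y₂ ∈ V(H)` there is ONE rational
number `r` such that
* `chiHeightPairing V H G χ y₁ y₂ = r · [H:ℚ] · ĥ(P)` (Néron–Tate side of (1.1.3)), and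
* for every prime `p`, every `ι : ℚ̄_p ≅ ℂ` and every `G`-INVARIANT datum `DH` on `V(H)`,
  `chiPAdicPairing ι V H DH G χ y₁ y₂ = r · ⟨P′, P′⟩_{DH}` (Theorem B side), `P′ = Φ_H(ιP)` the member's
  `H`-point (`twistPointEquivOver V ht htd (QuadraticDescent.incl H (V.quadraticTwist d) P)`).
Hence a PIN hypothesis stated on `P′` (`⟨P′, P′⟩_{DH} = canonicalPAdicHeightSqMinusTwist V 2 d P`, the (U5d)
receptacle) makes BOTH clauses of `ChiLineGrossZagierClauses` statements about the generator `P` with the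
same `r`, which cancels against `q` when the clauses are divided. (`r = k₁k₂/(4|G|)` from the biquadratic
descent `2·Y_χ yᵢ = kᵢ·P′ + Tᵢ`.) [cite: Disegni2017, (1.1.3) (arXiv v3 PDF p. 4 L35–41) and Theorem B (PDF p. 8 L11–20)]
[cite: GrossZagier1986, V.§2 (p. 311)] [cite: SilvermanAEC2009, X.5 Cor. 5.4, Exercise 10.16, Prop. VIII.5.4(b)] -/
theorem exists_rat_chiPairings_eq [V.IsElliptic] [(V.quadraticTwist d).IsElliptic]
    (hu : u ∉ Set.range (algebraMap ℚ H)) (hue : u ^ 2 = algebraMap ℚ H e)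
    (hs : ∀ σ, ((χ σ : ℂˣ) : ℂ) = (s σ : ℂ)) (τ κ : H ≃ₐ[ℚ] H) (hτG : τ ∈ G) (hsτ : s ⟨τ, hτG⟩ = -1)
    (hcomm : ∀ x : H, τ (κ x) = κ (τ x)) (hκκ : ∀ x : H, κ (κ x) = x)
    (hfix : ∀ x : H, τ x = x → κ x = x → ∃ q : ℚ, algebraMap ℚ H q = x)
    (hτt : τ t = -t) (hτu : τ u = u) (hκu : κ u = -u)
    {P : (V.quadraticTwist d).toAffine.Point}
    (hgen : ∀ R : (V.quadraticTwist d).toAffine.Point,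
      ∃ (k : ℤ) (T : (V.quadraticTwist d).toAffine.Point), IsOfFinAddOrder T ∧ R = k • P + T)
    (htors : ∀ Q : ((V.quadraticTwist d).quadraticTwist e).toAffine.Point, IsOfFinAddOrder Q)
    (y₁ y₂ : (V.baseChange H).toAffine.Point) :
    ∃ r : ℚ,
      chiHeightPairing V H G χ y₁ y₂ =
        (((r : ℝ) * (Module.finrank ℚ H : ℝ) * canonicalHeight P : ℝ) : ℂ) ∧
      ∀ (p : ℕ) [Fact p.Prime] (ι : PadicAlgCl p ≃+* ℂ) (DH : PAdicHeightDataK V p H),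
        (∀ (σ : G) (a b : (V.baseChange H).toAffine.Point),
          DH.pairing (pointGalHom V H σ.1 a) (pointGalHom V H σ.1 b) = DH.pairing a b) →
        chiPAdicPairing ι V H DH G χ y₁ y₂ =
          algebraMap ℚ_[p] ℂ_[p] ((r : ℚ_[p]) *
            DH.pairing (twistPointEquivOver V ht htd (QuadraticDescent.incl H (V.quadraticTwist d) P))
              (twistPointEquivOver V ht htd (QuadraticDescent.incl H (V.quadraticTwist d) P))) := by
  set P' := twistPointEquivOver V ht htd (QuadraticDescent.incl H (V.quadraticTwist d) P) with hP'_def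
  -- the two projectors lie on the `χ`-line, so the descent applies to each
  obtain ⟨k₁, T₁, hT₁, h₁⟩ := two_smul_eq_zsmul_memberPoint_add_torsion V ht htd hu hue τ κ hcomm hκκ hfix
    hτt hτu hκu hgen htors _ (map_sum_sign_smul_eq_neg V G χ s hs hτG hsτ y₁)
  obtain ⟨k₂, T₂, hT₂, h₂⟩ := two_smul_eq_zsmul_memberPoint_add_torsion V ht htd hu hue τ κ hcomm hκκ hfix
    hτt hτu hκu hgen htors _ (map_sum_sign_smul_eq_neg V G χ s hs hτG hsτ y₂)
  have hG0 : (Nat.card G : ℚ) ≠ 0 := by exact_mod_cast Nat.card_pos.ne'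
  refine ⟨(k₁ * k₂ : ℚ) / (4 * Nat.card G), ?_, fun p _ ι DH hDH => ?_⟩
  · -- Néron–Tate side
    have hNT := card_mul_mul_chiHeightPairing_eq G χ s hs h₁ h₂ hT₁ hT₂
    rw [← hP'_def, canonicalHeight_memberPoint V ht htd P] at hNT
    have hG0' : (Nat.card G : ℂ) ≠ 0 := by exact_mod_cast Nat.card_pos.ne'
    have h4 : (Nat.card G : ℂ) * (2 : ℤ) * (2 : ℤ) = 4 * (Nat.card G : ℂ) := by push_cast; ring
    rw [h4] at hNT
    have : chiHeightPairing V H G χ y₁ y₂ =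
        (4 * (Nat.card G : ℂ))⁻¹ * (((k₁ : ℝ) * (k₂ : ℝ) * ((Module.finrank ℚ H : ℝ) * canonicalHeight P) : ℝ) : ℂ) := by
      rw [← hNT, ← mul_assoc, inv_mul_cancel₀ (mul_ne_zero (by norm_num) hG0'), one_mul]
    rw [this]
    push_cast
    field_simp
  · -- `p`-adic side
    have hPA := card_mul_mul_chiPAdicPairing_eq ι DH G χ s hs hDH h₁ h₂ hT₁ hT₂
    have hG0' : (Nat.card G : ℂ_[p]) ≠ 0 := by exact_mod_cast Nat.card_pos.ne'
    have h4 : (Nat.card G : ℂ_[p]) * (2 : ℤ) * (2 : ℤ) = 4 * (Nat.card G : ℂ_[p]) := by push_cast; ring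
    rw [h4] at hPA
    have h4' : (4 : ℂ_[p]) * (Nat.card G : ℂ_[p]) ≠ 0 := mul_ne_zero (by norm_num) hG0'
    have : chiPAdicPairing ι V H DH G χ y₁ y₂ =
        (4 * (Nat.card G : ℂ_[p]))⁻¹ * algebraMap ℚ_[p] ℂ_[p] ((k₁ : ℚ_[p]) * (k₂ : ℚ_[p]) * DH.pairing P' P') := by
      rw [← hPA, ← mul_assoc, inv_mul_cancel₀ h4', one_mul]
    rw [this]
    have hG0'' : (Nat.card G : ℚ_[p]) ≠ 0 := by exact_mod_cast Nat.card_pos.ne'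
    have hinv : (4 * (Nat.card G : ℂ_[p]))⁻¹ = algebraMap ℚ_[p] ℂ_[p] ((4 * (Nat.card G : ℚ_[p]))⁻¹) := by
      rw [map_inv₀, map_mul, map_natCast, map_ofNat]
    rw [hinv, ← map_mul]
    congr 1
    push_cast
    field_simp

end Seam


end Summit.BirchSwinnertonDyer.BirchSwinnertonDyer.Theorems.PrintCf2.DisegniPairTwo

end
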